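import Literature.AlgebraicGeometry.Resolution.AlterationsSemiStableCodimTwoBlowupReduction
import Literature.AlgebraicGeometry.Resolution.AlterationsSemiStableCodimTwoBlowupFibreModels
import Literature.AlgebraicGeometry.Resolution.SmoothFibreChart
import HarnessLib

/-!
# `WildQuotients.SummitReduction` (stmt-ResolutionOfSingularities-16324), line `FramePerfect`:
# level-bijective maps — localization at corresponding primes and the completions of a pair
# (algebra of stub `stub_pair_orbitBlowupCentreLocal`, file 8)

Route `ResolutionOfSingularities/WildQuotients`, crux `SummitReduction`; helper file of stub
`stub_pair_orbitBlowupCentreLocal` (C2: de Jong 1996, 3.4 Claim (ii) over the orbit centre, with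
quasi-splitness upstairs — de Jong 1997, proof of Prop. 5.11 ¶1). Files 1–7 identify the completed
(fibre) local ring of the blown-up curve at a point `x'` over the centre with the completion of a
chart ring; what clauses (H4) (smoothness off the chart origins) and (H2) (the GEOMETRIC fibres) of
the stub still need is the comparison of the local rings of the base-changed fibre
`X₁ ×_Y Spec K` at the points over `x'` with the local rings of the base-changed chart model
`K[x, y]/(xy - ā)` ("This scheme is smooth over `k`, except at the maximal ideal `(u, t₁')`",
de Jong 1996, p. 64, read after an extension `K ⊇ k` of the residue field). Both rings map to
`K ⊗ R̂`, `R̂` the common completion, by maps whose levels are bijective; this file is the pure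
commutative algebra turning such a pair of level-bijective maps into an isomorphism of completed
LOCAL rings:

* `levelBijective_localization` — a ring map `f : S → T` with bijective levels `S/Iⁿ → T/IⁿT`
  stays level-bijective after localizing at a prime `𝔐 ⊇ IT` of `T` and its preimage in `S`
  (quotients commute with localization, and `S/Iⁿ ≅ T/IⁿT` matches the primes);
* `exists_isPrime_comap_eq_of_levelBijective`, `isMaximal_comap_of_levelBijective` — the primes of
  `S` over `I` are the preimages of the primes of `T` over `IT`, maximal ones corresponding to
  maximal ones (`S → T/IT` is onto with kernel `I`);
* `exists_localCpl_equiv_of_levelBijective_pair` — **two local rings `D₁`, `D₂` mapping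
  level-bijectively to the same ring `E` (levels of ideals `I₁ ⊆ 𝔪₁`, `I₂ ⊆ 𝔪₂` with the same
  image `J`) have isomorphic completions**, compatibly with the two maps: the levels of the MAXIMAL
  ideals are then bijective too (`quotientMap_pow_bijective_of_le`), onto the levels of the one
  ideal `𝔪₁E = 𝔪₂E` (both are the preimage of the maximal ideal of the local ring `E/J ≅ Dᵢ/Iᵢ`),
  and level-bijective maps complete to isomorphisms (`adicCompletionEquivOfQuotientMap`).
-/

set_option linter.dupNamespace false

noncomputable section

open IsLocalRing
open Literature.AlgebraicGeometry.Resolution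

namespace Summit.ResolutionOfSingularities.ResolutionOfSingularities.Theorems

universe u

/-! ## Primes over the level ideal -/

section Primes

variable {S T : Type u} [CommRing S] [CommRing T] (f : S →+* T) (I : Ideal S)

/-- Level one of a level-bijective map, in the form `S/I → T/IT`. [folklore] -/
theorem levelOne_bijective_of_levelBijective
    (hb : ∀ n, Function.Bijective (Ideal.quotientMap ((I ^ n).map f) f Ideal.le_comap_map)) :
    Function.Bijective (Ideal.quotientMap (I.map f) f Ideal.le_comap_map) :=
  (bijective_quotientMap_congr (congrArg (Ideal.map f) (pow_one I)) f (pow_one I)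
    Ideal.le_comap_map Ideal.le_comap_map).mp (hb 1)

/-- For `S/I → T/IT` bijective, `S → T/IT` is onto with kernel `I`. [folklore] -/
theorem surjective_and_ker_mk_comp_of_levelOne
    (hb1 : Function.Bijective (Ideal.quotientMap (I.map f) f Ideal.le_comap_map)) :
    Function.Surjective ((Ideal.Quotient.mk (I.map f)).comp f) ∧
      RingHom.ker ((Ideal.Quotient.mk (I.map f)).comp f) = I := by
  have hg : ∀ s, ((Ideal.Quotient.mk (I.map f)).comp f) s =
      Ideal.quotientMap (I.map f) f Ideal.le_comap_map (Ideal.Quotient.mk I s) := fun s => by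
    rw [RingHom.comp_apply, Ideal.quotientMap_mk]
  refine ⟨fun z => ?_, ?_⟩
  · obtain ⟨w, hw⟩ := hb1.2 z
    obtain ⟨s, rfl⟩ := Ideal.Quotient.mk_surjective w
    exact ⟨s, by rw [hg, hw]⟩
  · ext s
    rw [RingHom.mem_ker, hg]
    constructor
    · intro hs
      have h2 : Ideal.Quotient.mk I s = 0 := hb1.1 (by rw [hs, _root_.map_zero])
      exact Ideal.Quotient.eq_zero_iff_mem.mp h2
    · intro hs
      rw [Ideal.Quotient.eq_zero_iff_mem.mpr hs, _root_.map_zero]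

/-- **The primes of `S` over `I` are preimages of primes of `T` over `IT`** when `S/I → T/IT` is
bijective (both are the primes of `S/I ≅ T/IT`); a maximal prime is the preimage of a maximal one.
[folklore] -/
theorem exists_isPrime_comap_eq_of_levelBijective
    (hb1 : Function.Bijective (Ideal.quotientMap (I.map f) f Ideal.le_comap_map))
    (𝔑 : Ideal S) [𝔑.IsPrime] (h𝔑 : I ≤ 𝔑) :
    ∃ 𝔐 : Ideal T, 𝔐.IsPrime ∧ I.map f ≤ 𝔐 ∧ 𝔐.comap f = 𝔑 ∧ (𝔑.IsMaximal → 𝔐.IsMaximal) := by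
  obtain ⟨hgsurj, hker⟩ := surjective_and_ker_mk_comp_of_levelOne f I hb1
  set g : S →+* T ⧸ I.map f := (Ideal.Quotient.mk (I.map f)).comp f with hgdef
  have hker𝔑 : RingHom.ker g ≤ 𝔑 := by rw [hker]; exact h𝔑
  have hprime : (𝔑.map g).IsPrime := Ideal.map_isPrime_of_surjective hgsurj hker𝔑
  have hcomap : (𝔑.map g).comap g = 𝔑 := by
    rw [Ideal.comap_map_of_surjective g hgsurj, ← RingHom.ker_eq_comap_bot, sup_eq_left.mpr hker𝔑]
  refine ⟨(𝔑.map g).comap (Ideal.Quotient.mk (I.map f)), Ideal.comap_isPrime _ _, ?_, ?_, ?_⟩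
  · intro t ht
    rw [Ideal.mem_comap, Ideal.Quotient.eq_zero_iff_mem.mpr ht]
    exact Ideal.zero_mem _
  · rw [Ideal.comap_comap]
    exact hcomap
  · intro hmax
    have hne : 𝔑.map g ≠ ⊤ := fun htop => by
      rw [htop, Ideal.comap_top] at hcomap
      exact hmax.ne_top hcomap.symm
    haveI : (𝔑.map g).IsMaximal :=
      (Ideal.map_eq_top_or_isMaximal_of_surjective g hgsurj hmax).resolve_left hne
    exact Ideal.comap_isMaximal_of_surjective _ Ideal.Quotient.mk_surjective

/-- **The preimage of a maximal ideal `𝔐 ⊇ IT` along a map with `S/I → T/IT` bijective is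
maximal** (`S → T/𝔐` is onto). [folklore] -/
theorem isMaximal_comap_of_levelBijective
    (hb1 : Function.Bijective (Ideal.quotientMap (I.map f) f Ideal.le_comap_map))
    (𝔐 : Ideal T) [𝔐.IsMaximal] (h𝔐 : I.map f ≤ 𝔐) : (𝔐.comap f).IsMaximal := by
  obtain ⟨hgsurj, -⟩ := surjective_and_ker_mk_comp_of_levelOne f I hb1
  have hfac : (Ideal.Quotient.mk 𝔐).comp f =
      (Ideal.Quotient.factor h𝔐).comp ((Ideal.Quotient.mk (I.map f)).comp f) := by
    ext s
    simp only [RingHom.comp_apply, Ideal.Quotient.factor_mk]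
  have hsurj : Function.Surjective ((Ideal.Quotient.mk 𝔐).comp f) := by
    rw [hfac]
    exact (Ideal.Quotient.factor_surjective h𝔐).comp hgsurj
  have hk : RingHom.ker ((Ideal.Quotient.mk 𝔐).comp f) = 𝔐.comap f := by
    rw [← RingHom.comap_ker, Ideal.mk_ker]
  rw [← hk]
  letI := Ideal.Quotient.field 𝔐
  exact RingHom.ker_isMaximal_of_surjective _ hsurj

end Primes

/-! ## Localization of a level-bijective map at corresponding primes -/

section Localization

variable {S T : Type u} [CommRing S] [CommRing T] (f : S →+* T) (I : Ideal S)

/-- **Level-bijectivity localizes.** Let `f : S → T` have bijective levels `S/Iⁿ → T/IⁿT`, let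
`𝔐 ⊇ IT` be a prime of `T` and `𝔑 = f⁻¹𝔐`. Then the induced local homomorphism
`S_𝔑 → T_𝔐` has bijective levels `S_𝔑/IⁿS_𝔑 → T_𝔐/IⁿT_𝔐`: these are the localizations of
`S/Iⁿ ≅ T/IⁿT` at the corresponding primes `𝔑/Iⁿ ↔ 𝔐/IⁿT`. [folklore] -/
theorem levelBijective_localization
    (hb : ∀ n, Function.Bijective (Ideal.quotientMap ((I ^ n).map f) f Ideal.le_comap_map))
    (𝔐 : Ideal T) [𝔐.IsPrime] (h𝔐 : I.map f ≤ 𝔐) (n : ℕ) :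
    haveI : (𝔐.comap f).IsPrime := Ideal.comap_isPrime f 𝔐
    Function.Bijective (Ideal.quotientMap
      (((I.map (algebraMap S (Localization.AtPrime (𝔐.comap f)))) ^ n).map
        (Localization.localRingHom (𝔐.comap f) 𝔐 f rfl))
      (Localization.localRingHom (𝔐.comap f) 𝔐 f rfl) Ideal.le_comap_map) := by
  classical
  haveI h𝔑p : (𝔐.comap f).IsPrime := Ideal.comap_isPrime f 𝔐
  set 𝔑 : Ideal S := 𝔐.comap f with h𝔑def
  set S𝔑 := Localization.AtPrime 𝔑
  set T𝔐 := Localization.AtPrime 𝔐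
  set F : S𝔑 →+* T𝔐 := Localization.localRingHom 𝔑 𝔐 f rfl with hFdef
  have hF : ∀ s, F (algebraMap S S𝔑 s) = algebraMap T T𝔐 (f s) := fun s =>
    Localization.localRingHom_to_map 𝔑 𝔐 f rfl s
  have hI𝔑 : I ≤ 𝔑 := by rw [h𝔑def, ← Ideal.map_le_iff_le_comap]; exact h𝔐
  -- level `0` is the zero ring
  rcases Nat.eq_zero_or_pos n with rfl | hn
  · have htop : ((I.map (algebraMap S S𝔑)) ^ 0).map F = ⊤ := by
      rw [pow_zero, Ideal.one_eq_top, Ideal.map_top]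
    haveI : Subsingleton (T𝔐 ⧸ ((I.map (algebraMap S S𝔑)) ^ 0).map F) :=
      Ideal.Quotient.subsingleton_iff.mpr htop
    haveI : Subsingleton (S𝔑 ⧸ (I.map (algebraMap S S𝔑)) ^ 0) :=
      Ideal.Quotient.subsingleton_iff.mpr (by rw [pow_zero, Ideal.one_eq_top])
    exact ⟨fun a b _ => Subsingleton.elim a b, fun y => ⟨0, Subsingleton.elim _ _⟩⟩
  -- the level ideals `J = Iⁿ ⊆ 𝔑`, `JT ⊆ 𝔐`
  set J : Ideal S := I ^ n with hJdef
  set JT : Ideal T := J.map f with hJTdef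
  have hJ𝔑 : J ≤ 𝔑 := (Ideal.pow_le_self (Nat.pos_iff_ne_zero.mp hn)).trans hI𝔑
  have hJT𝔐 : JT ≤ 𝔐 := by
    rw [hJTdef, hJdef, Ideal.map_pow]
    exact (Ideal.pow_le_self (Nat.pos_iff_ne_zero.mp hn)).trans h𝔐
  haveI h𝔑b : (𝔑.map (Ideal.Quotient.mk J)).IsPrime := isPrime_map_quotient_mk 𝔑 hJ𝔑
  haveI h𝔐b : (𝔐.map (Ideal.Quotient.mk JT)).IsPrime := isPrime_map_quotient_mk 𝔐 hJT𝔐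
  haveI : IsLocalization.AtPrime (S𝔑 ⧸ J.map (algebraMap S S𝔑)) (𝔑.map (Ideal.Quotient.mk J)) :=
    isLocalization_atPrime_locQuot 𝔑 hJ𝔑
  haveI : IsLocalization.AtPrime (T𝔐 ⧸ JT.map (algebraMap T T𝔐)) (𝔐.map (Ideal.Quotient.mk JT)) :=
    isLocalization_atPrime_locQuot 𝔐 hJT𝔐
  -- `σ : S/J ≅ T/JT` and the matching of the primes
  let σ : (S ⧸ J) ≃+* (T ⧸ JT) := RingEquiv.ofBijective _ (hb n)
  have hσ : ∀ s, σ (Ideal.Quotient.mk J s) = Ideal.Quotient.mk JT (f s) := fun _ => rfl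
  have hmem𝔑 : ∀ s, Ideal.Quotient.mk J s ∈ 𝔑.map (Ideal.Quotient.mk J) ↔ s ∈ 𝔑 := fun s => by
    rw [Ideal.mem_quotient_iff_mem_sup, sup_eq_left.mpr hJ𝔑]
  have hmem𝔐 : ∀ t, Ideal.Quotient.mk JT t ∈ 𝔐.map (Ideal.Quotient.mk JT) ↔ t ∈ 𝔐 := fun t => by
    rw [Ideal.mem_quotient_iff_mem_sup, sup_eq_left.mpr hJT𝔐]
  have H : (𝔑.map (Ideal.Quotient.mk J)).primeCompl.map σ.toMonoidHom =
      (𝔐.map (Ideal.Quotient.mk JT)).primeCompl := by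
    ext z
    simp only [Submonoid.mem_map, Ideal.mem_primeCompl_iff]
    constructor
    · rintro ⟨w, hw, rfl⟩
      obtain ⟨s, rfl⟩ := Ideal.Quotient.mk_surjective w
      change σ (Ideal.Quotient.mk J s) ∉ _
      rw [hσ, hmem𝔐]
      rw [hmem𝔑] at hw
      exact fun h => hw (Ideal.mem_comap.mpr h)
    · intro hz
      obtain ⟨w, rfl⟩ := σ.surjective z
      obtain ⟨s, rfl⟩ := Ideal.Quotient.mk_surjective w
      refine ⟨Ideal.Quotient.mk J s, ?_, rfl⟩
      rw [hmem𝔑]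
      rw [hσ, hmem𝔐] at hz
      exact fun h => hz (Ideal.mem_comap.mp h)
  let ρ : (S𝔑 ⧸ J.map (algebraMap S S𝔑)) ≃+* (T𝔐 ⧸ JT.map (algebraMap T T𝔐)) :=
    IsLocalization.ringEquivOfRingEquiv (M := (𝔑.map (Ideal.Quotient.mk J)).primeCompl)
      (T := (𝔐.map (Ideal.Quotient.mk JT)).primeCompl) (S𝔑 ⧸ J.map (algebraMap S S𝔑))
      (T𝔐 ⧸ JT.map (algebraMap T T𝔐)) σ H
  have hρ : ∀ w, ρ (algebraMap (S ⧸ J) _ w) = algebraMap (T ⧸ JT) _ (σ w) := fun w =>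
    IsLocalization.ringEquivOfRingEquiv_eq H w
  -- the level ideals of the localizations
  have eI : (I.map (algebraMap S S𝔑)) ^ n = J.map (algebraMap S S𝔑) := by
    rw [hJdef, Ideal.map_pow]
  have eJ : ((I.map (algebraMap S S𝔑)) ^ n).map F = JT.map (algebraMap T T𝔐) := by
    rw [eI, hJTdef, Ideal.map_map, Ideal.map_map]
    congr 1
    exact RingHom.ext fun s => hF s
  have hle : J.map (algebraMap S S𝔑) ≤ (JT.map (algebraMap T T𝔐)).comap F := by
    rw [← eJ, ← eI]; exact Ideal.le_comap_map
  rw [bijective_quotientMap_congr eJ F eI Ideal.le_comap_map hle]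
  -- the level map is `ρ`
  have eS : ∀ s, Ideal.Quotient.mk (J.map (algebraMap S S𝔑)) (algebraMap S S𝔑 s) =
      algebraMap (S ⧸ J) _ (Ideal.Quotient.mk J s) := fun s => by
    rw [Ideal.Quotient.algebraMap_quotient_map_quotient]
  have eT : ∀ t, Ideal.Quotient.mk (JT.map (algebraMap T T𝔐)) (algebraMap T T𝔐 t) =
      algebraMap (T ⧸ JT) _ (Ideal.Quotient.mk JT t) := fun t => by
    rw [Ideal.Quotient.algebraMap_quotient_map_quotient]
  have key : (Ideal.quotientMap (JT.map (algebraMap T T𝔐)) F hle).comp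
      (Ideal.Quotient.mk (J.map (algebraMap S S𝔑))) =
      ρ.toRingHom.comp (Ideal.Quotient.mk (J.map (algebraMap S S𝔑))) := by
    apply IsLocalization.ringHom_ext 𝔑.primeCompl (S := S𝔑)
    ext s
    rw [RingHom.comp_apply, RingHom.comp_apply, Ideal.quotientMap_mk, hF, RingHom.comp_apply,
      RingHom.comp_apply, RingEquiv.toRingHom_eq_coe, RingHom.coe_coe, eS, hρ, hσ, eT]
  have hfun : (Ideal.quotientMap (JT.map (algebraMap T T𝔐)) F hle : _ → _) = ρ := by
    funext z
    obtain ⟨w, rfl⟩ := Ideal.Quotient.mk_surjective z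
    exact RingHom.congr_fun key w
  rw [hfun]
  exact ρ.bijective

end Localization

/-! ## The completions of a level-bijective pair -/

section Pair

variable {D E : Type u} [CommRing D] [CommRing E] [IsLocalRing D] (G : D →+* E) {I : Ideal D}

/-- For `I ⊆ 𝔪_D` and `D/I → E/J` bijective (`J = IE`), `E/J ≅ D/I` is a local ring. [folklore] -/
theorem isLocalRing_quotient_of_levelOne (hI : I ≤ maximalIdeal D) {J : Ideal E} (hIJ : I.map G = J)
    (hb1 : Function.Bijective (Ideal.quotientMap J G (hIJ ▸ Ideal.le_comap_map))) :
    IsLocalRing (E ⧸ J) := by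
  subst hIJ
  have hne : I ≠ ⊤ := fun h => (maximalIdeal.isMaximal D).ne_top (top_le_iff.mp (h ▸ hI))
  haveI : Nontrivial (D ⧸ I) := Ideal.Quotient.nontrivial_iff.mpr hne
  haveI : IsLocalRing (D ⧸ I) := IsLocalRing.of_surjective' (Ideal.Quotient.mk I) Ideal.Quotient.mk_surjective
  exact (RingEquiv.ofBijective _ hb1).isLocalRing

/-- **The extended maximal ideal `𝔪_D E` is the preimage of the maximal ideal of the local ring
`E/J`**, `J = IE` (for `I ⊆ 𝔪_D`, `D/I → E/J` bijective): `𝔪_D E ⊇ J` maps onto the maximal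
ideal of `E/J ≅ D/I`. [folklore] -/
theorem map_maximalIdeal_eq_comap_of_levelOne (hI : I ≤ maximalIdeal D) {J : Ideal E}
    (hIJ : I.map G = J)
    (hb1 : Function.Bijective (Ideal.quotientMap J G (hIJ ▸ Ideal.le_comap_map)))
    [IsLocalRing (E ⧸ J)] :
    (maximalIdeal D).map G = (maximalIdeal (E ⧸ J)).comap (Ideal.Quotient.mk J) := by
  subst hIJ
  have hne : I ≠ ⊤ := fun h => (maximalIdeal.isMaximal D).ne_top (top_le_iff.mp (h ▸ hI))
  haveI : Nontrivial (D ⧸ I) := Ideal.Quotient.nontrivial_iff.mpr hne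
  haveI : IsLocalRing (D ⧸ I) := IsLocalRing.of_surjective' (Ideal.Quotient.mk I) Ideal.Quotient.mk_surjective
  let σ : (D ⧸ I) ≃+* (E ⧸ I.map G) := RingEquiv.ofBijective _ hb1
  have hcomp : (Ideal.Quotient.mk (I.map G)).comp G = σ.toRingHom.comp (Ideal.Quotient.mk I) :=
    RingHom.ext fun _ => rfl
  have h1 : ((maximalIdeal D).map G).map (Ideal.Quotient.mk (I.map G)) = maximalIdeal (E ⧸ I.map G) := by
    rw [Ideal.map_map, hcomp, ← Ideal.map_map,
      IsLocalRing.map_maximalIdeal_of_surjective (Ideal.Quotient.mk I) Ideal.Quotient.mk_surjective]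
    exact IsLocalRing.eq_maximalIdeal
      (Ideal.IsMaximal.map_bijective σ.toRingHom σ.bijective (maximalIdeal.isMaximal _))
  rw [← h1, Ideal.comap_map_of_surjective _ Ideal.Quotient.mk_surjective, ← RingHom.ker_eq_comap_bot,
    Ideal.mk_ker, sup_eq_left.mpr (Ideal.map_mono hI)]

/-- **Two local rings mapping level-bijectively to one ring have isomorphic completions.** Let
`G₁ : D₁ → E`, `G₂ : D₂ → E` be ring maps from local rings with bijective levels
`Dᵢ/Iᵢⁿ → E/IᵢⁿE` for ideals `Iᵢ ⊆ 𝔪_{Dᵢ}` with the same extension `I₁E = I₂E`. Then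
`D̂₁ ≅ D̂₂` (completions at the maximal ideals), compatibly with `G₁`, `G₂`: the levels of the
maximal ideals are bijective as well (`quotientMap_pow_bijective_of_le`), onto the levels of the
single ideal `𝔪_{D₁}E = 𝔪_{D₂}E` of `E` (`map_maximalIdeal_eq_comap_of_levelOne`), and a
level-bijective map completes to an isomorphism (`adicCompletionEquivOfQuotientMap`). [folklore] -/
theorem exists_localCpl_equiv_of_levelBijective_pair {D₁ D₂ E : Type u} [CommRing D₁] [CommRing D₂]
    [CommRing E] [IsLocalRing D₁] [IsLocalRing D₂] (G₁ : D₁ →+* E) (G₂ : D₂ →+* E)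
    {I₁ : Ideal D₁} {I₂ : Ideal D₂} (hI₁ : I₁ ≤ maximalIdeal D₁) (hI₂ : I₂ ≤ maximalIdeal D₂)
    (hJ : I₁.map G₁ = I₂.map G₂)
    (hb₁ : ∀ n, Function.Bijective (Ideal.quotientMap ((I₁ ^ n).map G₁) G₁ Ideal.le_comap_map))
    (hb₂ : ∀ n, Function.Bijective (Ideal.quotientMap ((I₂ ^ n).map G₂) G₂ Ideal.le_comap_map)) :
    ∃ ε : LocalCpl D₁ ≃+* LocalCpl D₂, ∀ d₁ d₂, G₁ d₁ = G₂ d₂ →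
      ε (AdicCompletion.of _ _ d₁) = AdicCompletion.of _ _ d₂ := by
  -- the levels of the maximal ideals
  have hm₁ := quotientMap_pow_bijective_of_le G₁ hI₁ hb₁
  have hm₂ := quotientMap_pow_bijective_of_le G₂ hI₂ hb₂
  -- `𝔪₁E = 𝔪₂E`: both are the preimage of the maximal ideal of `E/J`
  set J : Ideal E := I₁.map G₁ with hJdef
  have l₁ : Function.Bijective (Ideal.quotientMap J G₁ (hJdef ▸ Ideal.le_comap_map)) :=
    levelOne_bijective_of_levelBijective G₁ I₁ hb₁
  have l₂ : Function.Bijective (Ideal.quotientMap J G₂ (hJ ▸ Ideal.le_comap_map)) :=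
    (bijective_quotientMap_congr hJ.symm G₂ rfl Ideal.le_comap_map (hJ ▸ Ideal.le_comap_map)).mp
      (levelOne_bijective_of_levelBijective G₂ I₂ hb₂)
  haveI : IsLocalRing (E ⧸ J) := isLocalRing_quotient_of_levelOne G₁ hI₁ rfl l₁
  have e₁ := map_maximalIdeal_eq_comap_of_levelOne G₁ hI₁ rfl l₁
  have e₂ := map_maximalIdeal_eq_comap_of_levelOne G₂ hI₂ hJ.symm l₂
  have hM : (maximalIdeal D₁).map G₁ = (maximalIdeal D₂).map G₂ := e₁.trans e₂.symm
  set M : Ideal E := (maximalIdeal D₁).map G₁ with hMdef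
  -- the two completions of `E` at `M`
  have hb₁' : ∀ n, Function.Bijective (Ideal.quotientMap (M ^ n) G₁
      (pow_le_comap_pow_of_map_le G₁ (le_refl M) n)) := fun n =>
    (bijective_quotientMap_congr (Ideal.map_pow G₁ _ n) G₁ rfl Ideal.le_comap_map
      (pow_le_comap_pow_of_map_le G₁ (le_refl M) n)).mp (hm₁ n)
  have hMpow : ∀ n, (maximalIdeal D₂ ^ n).map G₂ = M ^ n := fun n => by
    rw [Ideal.map_pow, ← hM]
  have hb₂' : ∀ n, Function.Bijective (Ideal.quotientMap (M ^ n) G₂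
      (pow_le_comap_pow_of_map_le G₂ hM.symm.le n)) := fun n =>
    (bijective_quotientMap_congr (hMpow n) G₂ rfl Ideal.le_comap_map
      (pow_le_comap_pow_of_map_le G₂ hM.symm.le n)).mp (hm₂ n)
  let ε₁ := adicCompletionEquivOfQuotientMap (maximalIdeal D₁) M G₁ (le_refl M) hb₁'
  let ε₂ := adicCompletionEquivOfQuotientMap (maximalIdeal D₂) M G₂ hM.symm.le hb₂'
  refine ⟨ε₁.trans ε₂.symm, ?_⟩
  intro d₁ d₂ h
  rw [RingEquiv.trans_apply, RingEquiv.symm_apply_eq]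
  change adicCompletionEquivOfQuotientMap _ _ _ _ hb₁' (AdicCompletion.of _ _ d₁) =
    adicCompletionEquivOfQuotientMap _ _ _ _ hb₂' (AdicCompletion.of _ _ d₂)
  rw [adicCompletionEquivOfQuotientMap_of, adicCompletionEquivOfQuotientMap_of, h]

end Pair

end Summit.ResolutionOfSingularities.ResolutionOfSingularities.Theorems

end
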